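import Summits.QuantumFields.BalabanUV.Beta.FP.WordPointwiseShapeHk
import Summits.QuantumFields.BalabanUV.Beta.FP.FineSplitJunctionTwoLeg

/-!
# `BalabanUV.Beta.FP.BlockTermsPieces` — road «FP» for binder row D1, ROW KER-γ (α2) sub-row α2-a PART 2 (owner memo `KER-GAMMA-ALPHA2.md` §5∕§9,
# R-FP-35 (c), R-FP-36 (b), owner word l.28227 (2) «the α2-a PART 2 instance is OPEN TO YOU»): THE MIX PIECES OF THE JUNCTION — the windowed
# `blockTerms` table of α2-a PART 1 (`FineHessianBlockSplit`: 3 tadpole + 15 two-leg bubble words at the `s`-shifted families) CUT INTO NAMED PIECES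
# `mixPiece κ A S Wf Nw k` (`k ∈ (Bool×Bool) ⊕ (Bool×Bool×Bool×Bool)`), with, PER PIECE: the split identity (the `hmix` binder of the owner's (LEDGER) skeleton
# `FineHessianNearLedger`), block periodicity, an entry bound (`hGmix`), the POINTWISE MIX SHAPE (hk) from DISPLAYED block letters of the leg and
# DISPLAYED r-weighted block masses of the stencils ∕ bi-tables (`WordPointwiseShapeHk.hk_biBubble` ∕ `hk_tadpole'`), and the LEDGER LINE (`hLmix`)
# composed BY NAME with F `FineSplitJunctionTwoLeg.rem_of_twoLeg`

HONEST DEPENDENCY (page 1, mandatory): continuum YM on T⁴ ⇐ BetaPertH ∧ nine spine estimates (0/9 proved); BetaPertH ⇐ (D1) ∧ (D4) ∧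
CAP+tail; G-an2-4 gates asym, D1 and NE2/3/4.  HONEST FRAMING (cell contract, verbatim): «discharging `BetaPertH` makes Bałaban's UV
stability UNCONDITIONAL — a real constructive-QFT result; it is NOT the continuum limit and NOT the Clay problem.»  THIS MODULE is [folklore]
bookkeeping over `PackedKernelSplit` (`blk`, `blockTerms`, `biBubble`), `ExpKernelCalculus` (`tadpole`, `shiftK`, `comp_shiftK`, `tr_shiftK`), this
lineage's `WordPointwiseShape(Hk)` and `FineSplitJunctionTwoLeg`, plus three small [our object] DATA definitions (`tadWord`, `bubWord`, `mixPiece` —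
the pieces, asserting nothing).  No `def … : Prop`, nothing cited, nothing of the manuscripts under audit asserted, 0 sorry.  EVERY letter of the
road's objects (the block sup-constants `CA i j` of the axial pack `Π K_m Π`, the block masses of `coProj N (S m)` ∕ `Wf m`, their sup letters, the
column letters (J)(J′)) is DISPLAYED AS A HYPOTHESIS — N0b-S∕W data (owner's INTERFACE REQUEST D1 l.28259), instantiated by nobody here.  NOT (γ) (the
N-power of the `Q̇` rows is READ OFF the displayed masses by the owner), NOT (LEDGER)'s numbers, NOT hsplit, NOT (ASYMP), NOT D1; 0∕4 row-D1 binders; NOT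
BetaPertH, NOT continuum, NOT Clay.  «not in print; our bookkeeping».

ABSOLUTE RULE (cell charter, verbatim): «No internally-minted statement may enter as a cited fact. Every hypothesis is either kernel-proved in this
package or a verbatim quotation of a PUBLISHED theorem with page reference. The manuscript(s) under audit are NOT citable for their own disputed
steps — they are the thing under adjudication; programme-internal (2001/route/tribunal) claims are never citable.»

CONTENT.
* §1 [our object] `tadWord A Wf (i,j)` (`½·tadpole A_ij (Wf c s e s′)_ji`, zero at `(f,f)`-slot `(true,true)`), `bubWord A S (i,j,k,l)`
  (`−½·biBubble A_ij (S c s)_jk A_kl (S e s′)_li`, zero at the all-field slot), `mixPiece κ A S Wf Nw k` (the window `‖s′−s‖∞ ≤ Nw` applied);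
  [folklore] **`window_blockTerms_eq_sum_mixPiece`** — THE SPLIT (`hmix`): `𝟙·blockTerms A S^s Wf^s c e (s′−s) = Σ_k mixPiece κ A S Wf Nw k c e s s′`.
* §2 [folklore] BLOCK PERIODICITY `isBlockPeriodic_mixPiece` (leg `N`-block covariant, stencils∕bi-tables `N`-block covariant ⟹ every piece is jointly
  `N`-block periodic — the `hGper` binder of `rem_of_twoLeg`).
* §3 [folklore] THE POINTWISE MIX SHAPES **`hk_mixPiece_inr`** (bubble pieces: `E₀ = ½|κ|·CA i j·CA k l`, masses `MS j k c ·`, `MS l i e ·`, rate `2δ₀∕N`) and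
  **`hk_mixPiece_inl`** (tadpole pieces: `E₀ = ½·CA i j`, product masses `MW₁ j i c ·`, `MW₂ j i e ·`, rate `2(δ₀∕2)∕N`); entry bounds `bounded_mixPiece_inr∕inl`
  from DISPLAYED sup letters on the masses (the `hGmix` binder).
* §4 [folklore] THE LEDGER LINES **`ledger_mixPiece_inr`** ∕ **`ledger_mixPiece_inl`** — `rem_of_twoLeg` BY NAME: per piece, `∀ S′, Σ_{u∈S′}‖u‖∞²·|dressedEntryP
  (colH K N · 0 ·) (mixPiece … k) (N•(−u)) a b| ≤ 16·(3·(1+20∕δ²)·E₀·C_J·C_J′·A₁·A₂)` from the column letters (J)(J′), the window mass letters (A₁)(A₂) and §2–§3.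
Provenance: D1 formalisation swarm LEAF PROVER 01, unit `b2b-balaban-beta-d1-formalise-leaf-01` gen 12, 2026-08-21, road FP row KER-γ (α2) α2-a PART 2.
-/

noncomputable section

namespace Summit.QuantumFields.BalabanUV.Beta.FP.BlockTermsPieces

open Finset
open scoped BigOperators
open Literature.MathematicalPhysics.QuantumFieldTheory.Balaban1983to89
open Literature.MathematicalPhysics.QuantumFieldTheory.Balaban1983to89.Beta
open B12Sec2to5 (l1)
open ExpKernelCalculus (Site MKer Decays comp tr bubble tadpole shiftK comp_shiftK tr_shiftK tadpole_shiftK)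
open Summit.QuantumFields.BalabanUV.Beta.TameKernelCalculus (Spr Loc)
open OneStepResolventKernel (Fib)
open OneStepKernelFamily (colH)
open DyadicShell (Pt supNorm)
open Summit.QuantumFields.BalabanUV.Beta.D1BFx.PackedKernelSplit (blk biBubble blockTerms tadpole_eq_blk_sum bubble_eq_blk_sum bubble_eq_biBubble)
open Summit.QuantumFields.BalabanUV.Beta.D1BFx.MomentTransferPeriodic (IsBlockPeriodic)
open Summit.QuantumFields.BalabanUV.Beta.D1BFx.MomentTransferPeriodicEntry (EKer₂ dressedEntryP)
open Summit.QuantumFields.BalabanUV.Beta.FP.TransportInfinityM (colOf)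
open Summit.QuantumFields.BalabanUV.Beta.FP.WordPointwiseShape (mass_nonneg_of_letter)
open Summit.QuantumFields.BalabanUV.Beta.FP.WordPointwiseShapeHk (hk_biBubble hk_tadpole')
open Summit.QuantumFields.BalabanUV.Beta.FP.FineSplitJunctionTwoLeg (rem_of_twoLeg)

variable {F : Type*} [Fintype F]

/-! ## §1 The pieces and the split -/

/-- [our object] **THE TADPOLE MIX WORD** at the slot `(i, j)`: `½·tadpole A_ij (Wf c s e s′)_ji`; the all-field slot `(true, true)` is the gluon word and is
NOT a MIX piece (zero here).  A DEFINITION; asserts nothing. -/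
def tadWord (A : MKer 4 (F ⊕ F)) (Wf : Fin 4 → Site 4 → Fin 4 → Site 4 → MKer 4 (F ⊕ F)) : Bool × Bool → EKer₂ 4
  | (i, j) => fun c e s s' => bif (i && j) then 0 else (1 / 2 : ℝ) * tadpole (blk A i j) (blk (Wf c s e s') j i)

/-- [our object] **THE TWO-LEG BUBBLE MIX WORD** at the slot `(i, j, k, l)`: `−½·biBubble A_ij (S c s)_jk A_kl (S e s′)_li`; the all-field slot is the gluon
word (zero here).  A DEFINITION; asserts nothing. -/
def bubWord (κ : ℝ) (A : MKer 4 (F ⊕ F)) (S : Fin 4 → Site 4 → MKer 4 (F ⊕ F)) : Bool × Bool × Bool × Bool → EKer₂ 4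
  | (i, j, k, l) => fun c e s s' =>
      bif (i && j && k && l) then 0 else -(κ / 2) * biBubble (blk A i j) (blk (S c s) j k) (blk A k l) (blk (S e s') l i)

/-- [our object] **THE WINDOWED MIX PIECES** of the junction: on the window `‖s′ − s‖∞ ≤ Nw` the tadpole words (`Sum.inl`) and the bubble words
(`Sum.inr`), zero off the window.  A DEFINITION; asserts nothing. -/
def mixPiece (κ : ℝ) (A : MKer 4 (F ⊕ F)) (S : Fin 4 → Site 4 → MKer 4 (F ⊕ F)) (Wf : Fin 4 → Site 4 → Fin 4 → Site 4 → MKer 4 (F ⊕ F))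
    (Nw : ℕ) (k : (Bool × Bool) ⊕ (Bool × Bool × Bool × Bool)) : EKer₂ 4 :=
  fun c e s s' => if supNorm (s' - s) ≤ Nw then Sum.elim (tadWord A Wf) (bubWord κ A S) k c e s s' else 0

/-- [our object] Unfolding a tadpole piece. -/
theorem mixPiece_inl (κ : ℝ) (A : MKer 4 (F ⊕ F)) (S : Fin 4 → Site 4 → MKer 4 (F ⊕ F)) (Wf : Fin 4 → Site 4 → Fin 4 → Site 4 → MKer 4 (F ⊕ F))
    (Nw : ℕ) (i j : Bool) (c e : Fin 4) (s s' : Pt) :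
    mixPiece κ A S Wf Nw (Sum.inl (i, j)) c e s s'
      = if supNorm (s' - s) ≤ Nw then (bif (i && j) then 0 else (1 / 2 : ℝ) * tadpole (blk A i j) (blk (Wf c s e s') j i)) else 0 := rfl

/-- [our object] Unfolding a bubble piece. -/
theorem mixPiece_inr (κ : ℝ) (A : MKer 4 (F ⊕ F)) (S : Fin 4 → Site 4 → MKer 4 (F ⊕ F)) (Wf : Fin 4 → Site 4 → Fin 4 → Site 4 → MKer 4 (F ⊕ F))
    (Nw : ℕ) (i j k l : Bool) (c e : Fin 4) (s s' : Pt) :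
    mixPiece κ A S Wf Nw (Sum.inr (i, j, k, l)) c e s s'
      = if supNorm (s' - s) ≤ Nw then
          (bif (i && j && k && l) then 0 else -(κ / 2) * biBubble (blk A i j) (blk (S c s) j k) (blk A k l) (blk (S e s') l i)) else 0 := rfl

/-- [folklore] **THE SPLIT OF THE WINDOWED BLOCK TERMS INTO THE MIX PIECES** (the `hmix` binder of the (LEDGER) skeleton, UNWEIGHTED bubble `κ = 1`):
at the `s`-shifted families of `FineHessianBlockSplit.fineHessA_eq_fineHessA_ff_add_blockTerms`,
`𝟙[‖s′−s‖∞ ≤ Nw]·blockTerms A S^s Wf^s c e (s′ − s) = Σ_k mixPiece 1 A S Wf Nw k c e s s′`. -/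
theorem window_blockTerms_eq_sum_mixPiece (A : MKer 4 (F ⊕ F)) (S : Fin 4 → Site 4 → MKer 4 (F ⊕ F))
    (Wf : Fin 4 → Site 4 → Fin 4 → Site 4 → MKer 4 (F ⊕ F)) (Nw : ℕ) (c e : Fin 4) (s s' : Pt) :
    (if supNorm (s' - s) ≤ Nw then
        blockTerms A (fun μ y => S μ (y + s)) (fun μ y ν y' => Wf μ (y + s) ν (y' + s)) c e (s' - s) else 0)
      = ∑ k, mixPiece 1 A S Wf Nw k c e s s' := by
  by_cases hw : supNorm (s' - s) ≤ Nw
  · simp only [mixPiece, hw, if_true, Fintype.sum_sum_type, Fintype.sum_prod_type, Sum.elim_inl, Sum.elim_inr, tadWord, bubWord,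
      blockTerms, zero_add, sub_add_cancel, Fintype.sum_bool, Bool.true_and, Bool.false_and, cond_true, cond_false]
    ring
  · simp [mixPiece, hw]

/-- [folklore] **THE SPLIT, WEIGHTED BUBBLE** (R-FP-37: after `StepJetData.hessKer_reweight` the road's table is `½·tadpole A Wf − ½κ·bubble A S S` with the
GENUINE bi-table, so its block terms carry `κ` on the 15 bubble words): the windowed weighted block sum, written out, `= Σ_k mixPiece κ A S Wf Nw k c e s s′`. -/
theorem window_weightedBlockTerms_eq_sum_mixPiece (κ : ℝ) (A : MKer 4 (F ⊕ F)) (S : Fin 4 → Site 4 → MKer 4 (F ⊕ F))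
    (Wf : Fin 4 → Site 4 → Fin 4 → Site 4 → MKer 4 (F ⊕ F)) (Nw : ℕ) (c e : Fin 4) (s s' : Pt) :
    (if supNorm (s' - s) ≤ Nw then
        (1 / 2) * (∑ i : Bool, ∑ j : Bool, bif (i && j) then 0 else tadpole (blk A i j) (blk (Wf c s e s') j i))
          - κ / 2 * (∑ i : Bool, ∑ j : Bool, ∑ k : Bool, ∑ l : Bool,
              bif (i && j && k && l) then 0 else biBubble (blk A i j) (blk (S c s) j k) (blk A k l) (blk (S e s') l i)) else 0)
      = ∑ k, mixPiece κ A S Wf Nw k c e s s' := by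
  by_cases hw : supNorm (s' - s) ≤ Nw
  · simp only [mixPiece, hw, if_true, Fintype.sum_sum_type, Fintype.sum_prod_type, Sum.elim_inl, Sum.elim_inr, tadWord, bubWord,
      Fintype.sum_bool, Bool.true_and, Bool.false_and, cond_true, cond_false]
    ring
  · simp [mixPiece, hw]

/-- [folklore] **THE WEIGHTED BLOCK SPLIT AT TABLE LEVEL** (spread leg, localised stencils and bi-table; `PackedKernelSplit.tadpole_eq_blk_sum` +
`bubble_eq_blk_sum`): `½·tadpole A (Wf c s e s′) − ½κ·bubble A (S c s) (S e s′)` = the weighted ff (gluon) word + the weighted block sum of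
`window_weightedBlockTerms_eq_sum_mixPiece` — so at `κ = 1` this is `hessKer = ff + blockTerms` read at the shifted families, and for general `κ` it is
the split the (LEDGER) skeleton's weighted `hslice` consumes. -/
theorem weightedTable_eq_ff_add_blockSum {A : MKer 4 (F ⊕ F)} (hA : Spr A) {S : Fin 4 → Site 4 → MKer 4 (F ⊕ F)}
    {Wf : Fin 4 → Site 4 → Fin 4 → Site 4 → MKer 4 (F ⊕ F)} (κ : ℝ) (c e : Fin 4) (s s' : Pt)
    (hS : Loc (S c s)) (hS' : Loc (S e s')) (hW : Loc (Wf c s e s')) :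
    (1 / 2) * tadpole A (Wf c s e s') - κ / 2 * bubble A (S c s) (S e s')
      = ((1 / 2) * tadpole (blk A true true) (blk (Wf c s e s') true true)
          - κ / 2 * biBubble (blk A true true) (blk (S c s) true true) (blk A true true) (blk (S e s') true true))
        + ((1 / 2) * (∑ i : Bool, ∑ j : Bool, bif (i && j) then 0 else tadpole (blk A i j) (blk (Wf c s e s') j i))
          - κ / 2 * (∑ i : Bool, ∑ j : Bool, ∑ k : Bool, ∑ l : Bool,
              bif (i && j && k && l) then 0 else biBubble (blk A i j) (blk (S c s) j k) (blk A k l) (blk (S e s') l i))) := by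
  rw [tadpole_eq_blk_sum hA hW, bubble_eq_blk_sum hA hS hS']
  simp only [Fintype.sum_bool, Bool.true_and, Bool.false_and, cond_true, cond_false]
  ring

/-! ## §2 Block periodicity -/

omit [Fintype F] in
/-- [folklore] blocks commute with shifts (definitional). -/
theorem blk_shiftK (v : Site 4) (K : MKer 4 (F ⊕ F)) (i j : Bool) : blk (shiftK v K) i j = shiftK v (blk K i j) := rfl

/-- [folklore] the two-leg bubble is invariant under a simultaneous shift of all four kernels. -/
theorem biBubble_shiftK (v : Site 4) (A V B W : MKer 4 F) :
    biBubble (shiftK v A) (shiftK v V) (shiftK v B) (shiftK v W) = biBubble A V B W := by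
  simp only [biBubble, comp_shiftK, tr_shiftK]

/-- [folklore] **EVERY MIX PIECE IS JOINTLY `N`-BLOCK PERIODIC** (the `hGper` binder of `rem_of_twoLeg`): leg `N`-block covariant
(`shiftK (−N•t) A = A`), stencils and bi-tables `N`-block covariant. -/
theorem isBlockPeriodic_mixPiece {N : ℕ} {A : MKer 4 (F ⊕ F)} {S : Fin 4 → Site 4 → MKer 4 (F ⊕ F)}
    {Wf : Fin 4 → Site 4 → Fin 4 → Site 4 → MKer 4 (F ⊕ F)}
    (hA : ∀ t : Site 4, shiftK (-((N : ℤ) • t)) A = A)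
    (hS : ∀ (κ : Fin 4) (u t : Site 4), S κ (u + (N : ℤ) • t) = shiftK (-((N : ℤ) • t)) (S κ u))
    (hW : ∀ (κ : Fin 4) (u : Site 4) (l : Fin 4) (u' t : Site 4), Wf κ (u + (N : ℤ) • t) l (u' + (N : ℤ) • t) = shiftK (-((N : ℤ) • t)) (Wf κ u l u'))
    (κ : ℝ) (Nw : ℕ) (k : (Bool × Bool) ⊕ (Bool × Bool × Bool × Bool)) (c e : Fin 4) :
    IsBlockPeriodic N (mixPiece κ A S Wf Nw k c e) := by
  intro t s s'
  have ew : supNorm (s' + (N : ℤ) • t - (s + (N : ℤ) • t)) = supNorm (s' - s) := by rw [add_sub_add_right_eq_sub]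
  rcases k with ⟨i, j⟩ | ⟨i, j, k, l⟩
  · rw [mixPiece_inl, mixPiece_inl, ew, hW]
    conv_lhs => rw [← hA t, blk_shiftK, blk_shiftK, tadpole_shiftK]
  · rw [mixPiece_inr, mixPiece_inr, ew, hS, hS]
    conv_lhs => rw [← hA t, blk_shiftK, blk_shiftK, blk_shiftK, blk_shiftK, biBubble_shiftK]

/-! ## §3 The pointwise MIX shapes and the entry bounds -/

section HK

variable [Nonempty F] {N Nw : ℕ} {κ : ℝ} {A : MKer 4 (F ⊕ F)} {S : Fin 4 → Site 4 → MKer 4 (F ⊕ F)}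
  {Wf : Fin 4 → Site 4 → Fin 4 → Site 4 → MKer 4 (F ⊕ F)} {CA : Bool → Bool → ℝ} {δ₀ : ℝ}
  {MS : Bool → Bool → Fin 4 → Pt → ℝ} {MW₁ MW₂ : Bool → Bool → Fin 4 → Pt → ℝ}

/-- **(hk) FOR THE BUBBLE PIECES** [folklore]: DISPLAYED block letters of the leg `∀ i j, Decays (blk A i j) (CA i j) (δ₀∕N)` and DISPLAYED r-weighted block
masses of the stencils `Σ_T e^{(δ₀∕N)|y−u|₁}·e^{(δ₀∕N)|z−u|₁}·|(S κ u)_jk y z f g| ≤ MS j k κ u` ⟹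
`|mixPiece κ … (inr (i,j,k,l)) c e s s′| ≤ MS j k c s·MS l i e s′·(½|κ|·(CA i j·CA k l))·e^{−(2δ₀∕N)‖s′−s‖∞}` — the (hk) binder of `rem_of_twoLeg` with
`M₁ c e := MS j k c`, `M₂ c e := MS l i e`, `E₀ := ½|κ|·CA i j·CA k l`, `δ := δ₀`. -/
theorem hk_mixPiece_inr (hδ₀ : 0 ≤ δ₀) (hA : ∀ i j, Decays (blk A i j) (CA i j) (δ₀ / N))
    (hMS : ∀ (j k : Bool) (κ : Fin 4) (u : Pt) (T : Finset (Site 4 × Site 4)), ∑ yz ∈ T, ∑ f, ∑ g,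
      Real.exp (δ₀ / N * l1 (yz.1 - u)) * Real.exp (δ₀ / N * l1 (yz.2 - u)) * |blk (S κ u) j k yz.1 yz.2 f g| ≤ MS j k κ u)
    (i j k l : Bool) (c e : Fin 4) (s s' : Pt) :
    |mixPiece κ A S Wf Nw (Sum.inr (i, j, k, l)) c e s s'|
      ≤ MS j k c s * MS l i e s' * (|κ| / 2 * (CA i j * CA k l)) * Real.exp (-(2 * δ₀ / N) * (supNorm (s' - s) : ℝ)) := by
  obtain ⟨a₀⟩ := ‹Nonempty F›
  have hC1 : 0 ≤ CA i j := (hA i j).nonneg a₀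
  have hC2 : 0 ≤ CA k l := (hA k l).nonneg a₀
  have hM1 : 0 ≤ MS j k c s := mass_nonneg_of_letter (hMS j k c s)
  have hM2 : 0 ≤ MS l i e s' := mass_nonneg_of_letter (hMS l i e s')
  have hR : 0 ≤ MS j k c s * MS l i e s' * (|κ| / 2 * (CA i j * CA k l)) * Real.exp (-(2 * δ₀ / N) * (supNorm (s' - s) : ℝ)) := by
    positivity
  rw [mixPiece_inr]
  split_ifs with hw
  · cases hb : (i && j && k && l)
    · simp only [cond_false]
      have h := hk_biBubble (V := fun s => blk (S c s) j k) (W := fun s' => blk (S e s') l i) (M₁ := MS j k c) (M₂ := MS l i e)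
        hδ₀ (hA i j) (hA k l) (hMS j k c) (hMS l i e) s s'
      rw [abs_mul, abs_neg, abs_div, abs_two]
      calc |κ| / 2 * |biBubble (blk A i j) (blk (S c s) j k) (blk A k l) (blk (S e s') l i)|
          ≤ |κ| / 2 * (MS j k c s * MS l i e s' * (CA i j * CA k l) * Real.exp (-(2 * δ₀ / N) * (supNorm (s' - s) : ℝ))) :=
            mul_le_mul_of_nonneg_left h (by positivity)
        _ = _ := by ring
    · simpa using hR
  · simpa using hR

/-- **(hk) FOR THE TADPOLE PIECES** [folklore]: DISPLAYED block letters of the leg and DISPLAYED product-form r-weighted block masses of the bi-tables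
`Σ_T e^{(δ₀∕N)|y−u|₁}·e^{(δ₀∕N)|z−u′|₁}·|(Wf κ u l u′)_ji y z f g| ≤ MW₁ j i κ u·MW₂ j i l u′` ⟹
`|mixPiece … (inl (i,j)) c e s s′| ≤ MW₁ j i c s·MW₂ j i e s′·(½·CA i j)·e^{−(2(δ₀∕2)∕N)‖s′−s‖∞}` — the (hk) binder with `E₀ := ½·CA i j`, `δ := δ₀∕2` (one leg). -/
theorem hk_mixPiece_inl (hδ₀ : 0 ≤ δ₀) (hA : ∀ i j, Decays (blk A i j) (CA i j) (δ₀ / N))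
    (hW1 : ∀ j i κ u, 0 ≤ MW₁ j i κ u) (hW2 : ∀ j i l u', 0 ≤ MW₂ j i l u')
    (hMW : ∀ (j i : Bool) (κ : Fin 4) (u : Pt) (l : Fin 4) (u' : Pt) (T : Finset (Site 4 × Site 4)), ∑ yz ∈ T, ∑ f, ∑ g,
      Real.exp (δ₀ / N * l1 (yz.1 - u)) * Real.exp (δ₀ / N * l1 (yz.2 - u')) * |blk (Wf κ u l u') j i yz.1 yz.2 f g|
        ≤ MW₁ j i κ u * MW₂ j i l u')
    (i j : Bool) (c e : Fin 4) (s s' : Pt) :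
    |mixPiece κ A S Wf Nw (Sum.inl (i, j)) c e s s'|
      ≤ MW₁ j i c s * MW₂ j i e s' * (1 / 2 * CA i j) * Real.exp (-(2 * (δ₀ / 2) / N) * (supNorm (s' - s) : ℝ)) := by
  obtain ⟨a₀⟩ := ‹Nonempty F›
  have hC1 : 0 ≤ CA i j := (hA i j).nonneg a₀
  have hR : 0 ≤ MW₁ j i c s * MW₂ j i e s' * (1 / 2 * CA i j) * Real.exp (-(2 * (δ₀ / 2) / N) * (supNorm (s' - s) : ℝ)) :=
    mul_nonneg (mul_nonneg (mul_nonneg (hW1 j i c s) (hW2 j i e s')) (by positivity)) (Real.exp_pos _).le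
  rw [mixPiece_inl]
  split_ifs with hw
  · cases hb : (i && j)
    · simp only [cond_false]
      have h := hk_tadpole' (W := fun s s' => blk (Wf c s e s') j i) (M₁ := MW₁ j i c) (M₂ := MW₂ j i e) hδ₀ (hA i j)
        (fun s s' => hMW j i c s e s') s s'
      rw [abs_mul, abs_of_pos (by norm_num : (0 : ℝ) < 1 / 2)]
      calc 1 / 2 * |tadpole (blk A i j) (blk (Wf c s e s') j i)|
          ≤ 1 / 2 * (MW₁ j i c s * MW₂ j i e s' * CA i j * Real.exp (-(2 * (δ₀ / 2) / N) * (supNorm (s' - s) : ℝ))) :=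
            mul_le_mul_of_nonneg_left h (by norm_num)
        _ = _ := by ring
    · simpa using hR
  · simpa using hR

/-- [folklore] ENTRY BOUND OF A BUBBLE PIECE from the (hk) shape and DISPLAYED sup letters on the stencil masses (the `hGmix` binder). -/
theorem bounded_mixPiece_inr (hδ₀ : 0 ≤ δ₀) (hA : ∀ i j, Decays (blk A i j) (CA i j) (δ₀ / N))
    (hMS : ∀ (j k : Bool) (κ : Fin 4) (u : Pt) (T : Finset (Site 4 × Site 4)), ∑ yz ∈ T, ∑ f, ∑ g,
      Real.exp (δ₀ / N * l1 (yz.1 - u)) * Real.exp (δ₀ / N * l1 (yz.2 - u)) * |blk (S κ u) j k yz.1 yz.2 f g| ≤ MS j k κ u)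
    {MSsup : ℝ} (hMSsup : ∀ j k κ u, MS j k κ u ≤ MSsup) (i j k l : Bool) (c e : Fin 4) :
    ∃ B, ∀ s s', |mixPiece κ A S Wf Nw (Sum.inr (i, j, k, l)) c e s s'| ≤ B := by
  obtain ⟨a₀⟩ := ‹Nonempty F›
  have hC1 : 0 ≤ CA i j := (hA i j).nonneg a₀
  have hC2 : 0 ≤ CA k l := (hA k l).nonneg a₀
  refine ⟨MSsup * MSsup * (|κ| / 2 * (CA i j * CA k l)), fun s s' => (hk_mixPiece_inr hδ₀ hA hMS i j k l c e s s').trans ?_⟩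
  have hM1 : 0 ≤ MS j k c s := mass_nonneg_of_letter (hMS j k c s)
  have hM2 : 0 ≤ MS l i e s' := mass_nonneg_of_letter (hMS l i e s')
  have hex : Real.exp (-(2 * δ₀ / N) * (supNorm (s' - s) : ℝ)) ≤ 1 :=
    Real.exp_le_one_iff.mpr (by
      have h0 : (0 : ℝ) ≤ (supNorm (s' - s) : ℝ) := Nat.cast_nonneg _
      have h1 : 0 ≤ 2 * δ₀ / N := by positivity
      nlinarith)
  calc MS j k c s * MS l i e s' * (|κ| / 2 * (CA i j * CA k l)) * Real.exp (-(2 * δ₀ / N) * (supNorm (s' - s) : ℝ))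
      ≤ MS j k c s * MS l i e s' * (|κ| / 2 * (CA i j * CA k l)) * 1 := mul_le_mul_of_nonneg_left hex (by positivity)
    _ ≤ MSsup * MSsup * (|κ| / 2 * (CA i j * CA k l)) * 1 := by
        apply mul_le_mul_of_nonneg_right _ zero_le_one
        exact mul_le_mul_of_nonneg_right (mul_le_mul (hMSsup j k c s) (hMSsup l i e s') hM2 ((hM1.trans (hMSsup j k c s))))
          (by positivity)
    _ = _ := by ring

/-- [folklore] ENTRY BOUND OF A TADPOLE PIECE from the (hk) shape and DISPLAYED sup letters on the product masses (the `hGmix` binder). -/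
theorem bounded_mixPiece_inl (hδ₀ : 0 ≤ δ₀) (hA : ∀ i j, Decays (blk A i j) (CA i j) (δ₀ / N))
    (hW1 : ∀ j i κ u, 0 ≤ MW₁ j i κ u) (hW2 : ∀ j i l u', 0 ≤ MW₂ j i l u')
    (hMW : ∀ (j i : Bool) (κ : Fin 4) (u : Pt) (l : Fin 4) (u' : Pt) (T : Finset (Site 4 × Site 4)), ∑ yz ∈ T, ∑ f, ∑ g,
      Real.exp (δ₀ / N * l1 (yz.1 - u)) * Real.exp (δ₀ / N * l1 (yz.2 - u')) * |blk (Wf κ u l u') j i yz.1 yz.2 f g|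
        ≤ MW₁ j i κ u * MW₂ j i l u')
    {MWsup : ℝ} (hMW1sup : ∀ j i κ u, MW₁ j i κ u ≤ MWsup) (hMW2sup : ∀ j i l u', MW₂ j i l u' ≤ MWsup) (i j : Bool) (c e : Fin 4) :
    ∃ B, ∀ s s', |mixPiece κ A S Wf Nw (Sum.inl (i, j)) c e s s'| ≤ B := by
  obtain ⟨a₀⟩ := ‹Nonempty F›
  have hC1 : 0 ≤ CA i j := (hA i j).nonneg a₀
  refine ⟨MWsup * MWsup * (1 / 2 * CA i j), fun s s' => (hk_mixPiece_inl hδ₀ hA hW1 hW2 hMW i j c e s s').trans ?_⟩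
  have hex : Real.exp (-(2 * (δ₀ / 2) / N) * (supNorm (s' - s) : ℝ)) ≤ 1 :=
    Real.exp_le_one_iff.mpr (by
      have h0 : (0 : ℝ) ≤ (supNorm (s' - s) : ℝ) := Nat.cast_nonneg _
      have h1 : 0 ≤ 2 * (δ₀ / 2) / N := by positivity
      nlinarith)
  calc MW₁ j i c s * MW₂ j i e s' * (1 / 2 * CA i j) * Real.exp (-(2 * (δ₀ / 2) / N) * (supNorm (s' - s) : ℝ))
      ≤ MW₁ j i c s * MW₂ j i e s' * (1 / 2 * CA i j) * 1 :=
        mul_le_mul_of_nonneg_left hex (mul_nonneg (mul_nonneg (hW1 j i c s) (hW2 j i e s')) (by positivity))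
    _ ≤ MWsup * MWsup * (1 / 2 * CA i j) * 1 := by
        apply mul_le_mul_of_nonneg_right _ zero_le_one
        exact mul_le_mul_of_nonneg_right (mul_le_mul (hMW1sup j i c s) (hMW2sup j i e s') (hW2 j i e s') ((hW1 j i c s).trans (hMW1sup j i c s)))
          (by positivity)
    _ = _ := by ring

end HK

/-! ## §4 The ledger lines, by name over `FineSplitJunctionTwoLeg.rem_of_twoLeg` -/

section Ledger

variable [Nonempty F] {N Nw : ℕ} {κ : ℝ} {K : MKer (3 + 1) (Fib 3)} {A : MKer 4 (F ⊕ F)} {S : Fin 4 → Site 4 → MKer 4 (F ⊕ F)}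
  {Wf : Fin 4 → Site 4 → Fin 4 → Site 4 → MKer 4 (F ⊕ F)} {CA : Bool → Bool → ℝ} {δ₀ C_J C_J' A₁ A₂ : ℝ}
  {MS : Bool → Bool → Fin 4 → Pt → ℝ} {MW₁ MW₂ : Bool → Bool → Fin 4 → Pt → ℝ} {a b : Fin 4}

/-- **THE LEDGER LINE OF A BUBBLE PIECE** [folklore] (the `hLmix (inr (i,j,k,l))` binder of the (LEDGER) skeleton): `K` block-covariant with absolutely
summable END columns and the column letters (J)(J′) at rate `δ₀`, the leg∕stencil∕bi-table covariance of §2, the DISPLAYED block letters and stencil masses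
of §3 with sup letter `MSsup` and the two WINDOW MASS LETTERS (A₁)(A₂) for `MS j k c ·` and `MS l i e ·` ⟹
`∀ S′, Σ_{u∈S′}‖u‖∞²·|dressedEntryP (colH K N · 0 ·) (mixPiece κ A S Wf Nw (inr (i,j,k,l))) (N•(−u)) a b| ≤ 16·(3·(1+20∕δ₀²)·(½|κ|·CA i j·CA k l)·C_J·C_J′·A₁·A₂)`. -/
theorem ledger_mixPiece_inr (hδ₀ : 0 < δ₀) (hN : 1 ≤ N) (hKcov : ∀ t : Fin (3 + 1) → ℤ, shiftK (-((N : ℤ) • t)) K = K)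
    (hcol : ∀ κ l' : Fin 4, Summable fun x => |colOf K κ l' x|)
    (hAcov : ∀ t : Site 4, shiftK (-((N : ℤ) • t)) A = A)
    (hScov : ∀ (κ : Fin 4) (u t : Site 4), S κ (u + (N : ℤ) • t) = shiftK (-((N : ℤ) • t)) (S κ u))
    (hWcov : ∀ (κ : Fin 4) (u : Site 4) (l : Fin 4) (u' t : Site 4),
      Wf κ (u + (N : ℤ) • t) l (u' + (N : ℤ) • t) = shiftK (-((N : ℤ) • t)) (Wf κ u l u'))
    (hA : ∀ i j, Decays (blk A i j) (CA i j) (δ₀ / N))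
    (hMS : ∀ (j k : Bool) (κ : Fin 4) (u : Pt) (T : Finset (Site 4 × Site 4)), ∑ yz ∈ T, ∑ f, ∑ g,
      Real.exp (δ₀ / N * l1 (yz.1 - u)) * Real.exp (δ₀ / N * l1 (yz.2 - u)) * |blk (S κ u) j k yz.1 yz.2 f g| ≤ MS j k κ u)
    {MSsup : ℝ} (hMSsup : ∀ j k κ u, MS j k κ u ≤ MSsup) (i j k l : Bool)
    (hA₁ : ∀ (c : Fin 4) (q : Pt) (T : Finset Pt), ∑ p ∈ T, Real.exp (-(δ₀ / (2 * N)) * (supNorm (p - q) : ℝ)) * MS j k c p ≤ A₁)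
    (hA₂ : ∀ (e : Fin 4) (q : Pt) (T : Finset Pt), ∑ x ∈ T, Real.exp (-(δ₀ / (2 * N)) * (supNorm (x - q) : ℝ)) * MS l i e x ≤ A₂)
    (hJ : ∀ (c : Fin 4) (p : Pt), |colH K N a 0 c p| ≤ C_J * Real.exp (-(δ₀ / N) * (supNorm (p - (N : ℤ) • (0 : Pt)) : ℝ)))
    (hJ' : ∀ (e : Fin 4) (S' : Finset Pt) (x : Pt), ∑ u ∈ S', (1 + ((supNorm (x - (N : ℤ) • u) : ℝ) / N) ^ 2) * |colH K N b u e x| ≤ C_J') :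
    ∀ S' : Finset Pt, ∑ u ∈ S', (supNorm u : ℝ) ^ 2 *
        |dressedEntryP (fun c a' => colH K N a' 0 c) (mixPiece κ A S Wf Nw (Sum.inr (i, j, k, l))) ((N : ℤ) • (-u)) a b|
      ≤ 16 * (3 * (1 + 20 / δ₀ ^ 2) * (|κ| / 2 * (CA i j * CA k l)) * C_J * C_J' * A₁ * A₂) := by
  obtain ⟨a₀⟩ := ‹Nonempty F›
  have hE₀ : 0 ≤ |κ| / 2 * (CA i j * CA k l) := by
    have h1 := (hA i j).nonneg a₀; have h2 := (hA k l).nonneg a₀; positivity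
  exact rem_of_twoLeg (G := mixPiece κ A S Wf Nw (Sum.inr (i, j, k, l))) (M₁ := fun c _ p => MS j k c p) (M₂ := fun _ e x => MS l i e x)
    hδ₀ hN hKcov hcol (fun c e => isBlockPeriodic_mixPiece hAcov hScov hWcov κ Nw _ c e)
    (fun c e => bounded_mixPiece_inr hδ₀.le hA hMS hMSsup i j k l c e) hE₀
    (fun c _ p => mass_nonneg_of_letter (hMS j k c p)) (fun _ e x => mass_nonneg_of_letter (hMS l i e x))
    (fun c e p x => hk_mixPiece_inr hδ₀.le hA hMS i j k l c e p x) (fun c _ q T => hA₁ c q T) (fun _ e q T => hA₂ e q T) hJ hJ'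

/-- **THE LEDGER LINE OF A TADPOLE PIECE** [folklore] (the `hLmix (inl (i,j))` binder): as above with the product-form bi-table masses, their sup letter
`MWsup`, the window mass letters (A₁) for `MW₁ j i c ·` and (A₂) for `MW₂ j i e ·` at rate `(δ₀∕2)∕(2N)`, and the column letter (J) at rate `(δ₀∕2)∕N`
(one leg ⟹ the two-leg core runs at `δ := δ₀∕2`) ⟹ `… ≤ 16·(3·(1+20∕(δ₀∕2)²)·(½·CA i j)·C_J·C_J′·A₁·A₂)`. -/
theorem ledger_mixPiece_inl (hδ₀ : 0 < δ₀) (hN : 1 ≤ N) (hKcov : ∀ t : Fin (3 + 1) → ℤ, shiftK (-((N : ℤ) • t)) K = K)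
    (hcol : ∀ κ l' : Fin 4, Summable fun x => |colOf K κ l' x|)
    (hAcov : ∀ t : Site 4, shiftK (-((N : ℤ) • t)) A = A)
    (hScov : ∀ (κ : Fin 4) (u t : Site 4), S κ (u + (N : ℤ) • t) = shiftK (-((N : ℤ) • t)) (S κ u))
    (hWcov : ∀ (κ : Fin 4) (u : Site 4) (l : Fin 4) (u' t : Site 4),
      Wf κ (u + (N : ℤ) • t) l (u' + (N : ℤ) • t) = shiftK (-((N : ℤ) • t)) (Wf κ u l u'))
    (hA : ∀ i j, Decays (blk A i j) (CA i j) (δ₀ / N))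
    (hW1 : ∀ j i κ u, 0 ≤ MW₁ j i κ u) (hW2 : ∀ j i l u', 0 ≤ MW₂ j i l u')
    (hMW : ∀ (j i : Bool) (κ : Fin 4) (u : Pt) (l : Fin 4) (u' : Pt) (T : Finset (Site 4 × Site 4)), ∑ yz ∈ T, ∑ f, ∑ g,
      Real.exp (δ₀ / N * l1 (yz.1 - u)) * Real.exp (δ₀ / N * l1 (yz.2 - u')) * |blk (Wf κ u l u') j i yz.1 yz.2 f g|
        ≤ MW₁ j i κ u * MW₂ j i l u')
    {MWsup : ℝ} (hMW1sup : ∀ j i κ u, MW₁ j i κ u ≤ MWsup) (hMW2sup : ∀ j i l u', MW₂ j i l u' ≤ MWsup) (i j : Bool)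
    (hA₁ : ∀ (c : Fin 4) (q : Pt) (T : Finset Pt), ∑ p ∈ T, Real.exp (-(δ₀ / 2 / (2 * N)) * (supNorm (p - q) : ℝ)) * MW₁ j i c p ≤ A₁)
    (hA₂ : ∀ (e : Fin 4) (q : Pt) (T : Finset Pt), ∑ x ∈ T, Real.exp (-(δ₀ / 2 / (2 * N)) * (supNorm (x - q) : ℝ)) * MW₂ j i e x ≤ A₂)
    (hJ : ∀ (c : Fin 4) (p : Pt), |colH K N a 0 c p| ≤ C_J * Real.exp (-(δ₀ / 2 / N) * (supNorm (p - (N : ℤ) • (0 : Pt)) : ℝ)))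
    (hJ' : ∀ (e : Fin 4) (S' : Finset Pt) (x : Pt), ∑ u ∈ S', (1 + ((supNorm (x - (N : ℤ) • u) : ℝ) / N) ^ 2) * |colH K N b u e x| ≤ C_J') :
    ∀ S' : Finset Pt, ∑ u ∈ S', (supNorm u : ℝ) ^ 2 *
        |dressedEntryP (fun c a' => colH K N a' 0 c) (mixPiece κ A S Wf Nw (Sum.inl (i, j))) ((N : ℤ) • (-u)) a b|
      ≤ 16 * (3 * (1 + 20 / (δ₀ / 2) ^ 2) * (1 / 2 * CA i j) * C_J * C_J' * A₁ * A₂) := by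
  obtain ⟨a₀⟩ := ‹Nonempty F›
  have hE₀ : 0 ≤ 1 / 2 * CA i j := by have h1 := (hA i j).nonneg a₀; positivity
  exact rem_of_twoLeg (G := mixPiece κ A S Wf Nw (Sum.inl (i, j))) (M₁ := fun c _ p => MW₁ j i c p) (M₂ := fun _ e x => MW₂ j i e x)
    (half_pos hδ₀) hN hKcov hcol (fun c e => isBlockPeriodic_mixPiece hAcov hScov hWcov κ Nw _ c e)
    (fun c e => bounded_mixPiece_inl hδ₀.le hA hW1 hW2 hMW hMW1sup hMW2sup i j c e) hE₀
    (fun c _ p => hW1 j i c p) (fun _ e x => hW2 j i e x)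
    (fun c e p x => hk_mixPiece_inl hδ₀.le hA hW1 hW2 hMW i j c e p x) (fun c _ q T => hA₁ c q T) (fun _ e q T => hA₂ e q T) hJ hJ'

end Ledger

end Summit.QuantumFields.BalabanUV.Beta.FP.BlockTermsPieces

end
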